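import Literature.MathematicalPhysics.QuantumManyBody.PeriodicBoseGasLemma24Facts
import Literature.MathematicalPhysics.QuantumManyBody.PeriodicBoseGasBogoliubovPlancherel
import Literature.MathematicalPhysics.QuantumManyBody.PeriodicBoseGasBogoliubovSquare
import Literature.MathematicalPhysics.QuantumManyBody.PeriodicBoseGasBogoliubovIntegrals
import Literature.Analysis.FluidPDE.NSFourierPlancherel
import HarnessLib

/-!
# Fournais 2020, Lemma 2.4 from (2.28), (2.29) and (2.42): the inputs of the assembly

Topic `Literature/MathematicalPhysics/QuantumManyBody` (provefact
`Literature.MathematicalPhysics.QuantumManyBody.BoseGas.Fournais2020_condensation`, layer `Fournais2020_lemma24`).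
The printed proof of [Fournais2020, Lemma 2.4] in first quantisation runs:

1. `kin - (b/ℓ²)n₊ ≥ 𝒯` (`kinExcForm_add_le_kinBoxN`) and (2.30) `𝒯 ≥ (ℓ³/n)∫τ‖b_pΦ‖²`
   (`lintegral_tau_normSq_bVec_le`), `τ(p) = (4π²p² - (sℓ)⁻²)₊`;
2. (2.31)–(2.32): add `2Ŵ₁(0)‖b_pΦ‖²` with `∫‖b_pΦ‖² ≤ ‖χ‖²_∞ nℓ⁻³ n₊` (`lintegral_lintegral_normSq_bVec_le`)
   and `|Ŵ₁| ≤ Ŵ₁(0) ≤ W₀ := (1 + 2C_T(R/ℓ)²)8πa` (`norm_fourier_bigW₁_le_sharp`);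
3. (2.29): `A₂ = ∫Ŵ₁ Re⟨b_p†Φ, b_{-p}Φ⟩` for the state at hand;
4. (2.33)–(2.35): symmetrise `p ↔ -p` and complete the square for a.e. `p`
   (`integral_pairing_lower_bound`: `bogoliubov_completion` with the commutator bound `Fournais2020_eq228`),
   giving `≥ -(n/2)‖Φ‖²∫(𝒜 - √(𝒜² - Ŵ₁²))`, `𝒜 = (ℓ³/n)τ + 2W₀`;
5. (2.36)–(2.41): `∫(𝒜 - √(𝒜² - Ŵ₁²)) ≤ (n/ℓ³)∫Ŵ₁²/(8π²p²) + E` (`lintegral_bogoliubov_integrand_le`,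
   `r₀ = (πsℓ)⁻¹`) with `E ≤ C(s)(a/ℓ³ + a²n/ℓ⁴ + a³n²/ℓ⁵)` (`lemma24_E_bound`) and AM–GM on the middle term;
6. (2.42): `∫Ŵ₁²/(8π²p²) ≤ (1 + 2C_T(R/ℓ)²)²∫gω` (`Fournais2020_eq242`), `∫gω ≤ 8πa`, `(1+ε)² ≤ 1 + 3ε`;
7. bookkeeping (`lemma24_main_term`, `lemma24_E_term`): the printed (2.26) with
   `C = 32π‖χ‖²_∞ + 24πC_T + 16/(3πs³) + 32/s + 1536πs + 1` and `c₁ = (2C_T + 2)^{-1/2}`.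

This file holds the inputs and the bookkeeping of steps 1, 2, 4–7 (the `L²` identities, the
finiteness of the kinetic excitation form, the completion of the square integrated in `p`, the
elementary estimates of the error terms). The assembly itself is carried out pointwise in the state in
`PeriodicBoseGasLemma24Bdd.lean` (`lemma24_of_pairing_identity`: (2.26) for every `Φ` for which (2.29)
holds) and closed in `PeriodicBoseGasLemma24Proofs.lean` (`Fournais2020_lemma24_holds`), where (2.29) is
supplied on the form domain of the box Hamiltonian by `Fournais2020_eq229_of_rep`
(`PeriodicBoseGasEq229.lean`) — the generality in which the paper uses it; (2.28) and (2.42) are the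
theorems `Fournais2020_eq228_holds`, `Fournais2020_eq242_holds`.

## References

* [Fournais2020] S. Fournais, *Length scales for BEC in the dilute Bose gas*, arXiv:2011.00309,
  EMS Ser. Congr. Rep. 18 (2021), doi:10.4171/ecr/18-1/7: Lemma 2.4, (2.26)–(2.43).
* [FournaisSolovej2020] S. Fournais, J. P. Solovej, *The energy of dilute Bose gases*, Ann. of Math. 192 (2020): App. A.
-/

noncomputable section

open MeasureTheory Set
open scoped ENNReal NNReal FourierTransform ComplexConjugate RealInnerProductSpace

namespace Literature.MathematicalPhysics.QuantumManyBody.BoseGas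

/-! ### `L²` bookkeeping: the square of a real combination -/

section L2

variable {α : Type*} [MeasurableSpace α] {μ : Measure α}

/-- `∫‖aF + bG‖² = a²∫‖F‖² + b²∫‖G‖² + 2ab Re∫conj(F)G` for `F, G ∈ L²` and real `a, b`. [folklore] -/
theorem integral_norm_sq_real_comb {F G : α → ℂ} (hF : MemLp F 2 μ) (hG : MemLp G 2 μ) (a b : ℝ) :
    ∫ x, ‖(a : ℂ) * F x + (b : ℂ) * G x‖ ^ 2 ∂μ =
      a ^ 2 * ∫ x, ‖F x‖ ^ 2 ∂μ + b ^ 2 * ∫ x, ‖G x‖ ^ 2 ∂μ + 2 * a * b * (∫ x, conj (F x) * G x ∂μ).re := by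
  have hF2 : Integrable (fun x => ‖F x‖ ^ 2) μ := (memLp_two_iff_integrable_sq_norm hF.1).1 hF
  have hG2 : Integrable (fun x => ‖G x‖ ^ 2) μ := (memLp_two_iff_integrable_sq_norm hG.1).1 hG
  have hFG : Integrable (fun x => conj (F x) * G x) μ := integrable_conj_mul hF hG
  have hpt : ∀ x, ‖(a : ℂ) * F x + (b : ℂ) * G x‖ ^ 2 =
      a ^ 2 * ‖F x‖ ^ 2 + b ^ 2 * ‖G x‖ ^ 2 + 2 * a * b * (conj (F x) * G x).re := by
    intro x
    rw [norm_add_sq_complex, norm_mul, norm_mul, Complex.norm_real, Complex.norm_real, mul_pow, mul_pow,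
      Real.norm_eq_abs, Real.norm_eq_abs, sq_abs, sq_abs, map_mul, Complex.conj_ofReal]
    have : (↑a * conj (F x) * (↑b * G x)).re = a * b * (conj (F x) * G x).re := by
      have h1 : (↑a * conj (F x) * (↑b * G x)) = ((a * b : ℝ) : ℂ) * (conj (F x) * G x) := by push_cast; ring
      rw [h1, Complex.re_ofReal_mul]
    rw [this]; ring
  simp_rw [hpt]
  have h1 : Integrable (fun x => a ^ 2 * ‖F x‖ ^ 2) μ := hF2.const_mul _
  have h2 : Integrable (fun x => b ^ 2 * ‖G x‖ ^ 2) μ := hG2.const_mul _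
  have h12 : Integrable (fun x => a ^ 2 * ‖F x‖ ^ 2 + b ^ 2 * ‖G x‖ ^ 2) μ := h1.add h2
  have h3 : Integrable (fun x => 2 * a * b * (conj (F x) * G x).re) μ := (hFG.re).const_mul _
  rw [integral_add h12 h3, integral_add h1 h2, integral_const_mul, integral_const_mul, integral_const_mul]
  congr 1
  have h4 : ∫ x, (conj (F x) * G x).re ∂μ = (∫ x, conj (F x) * G x ∂μ).re := integral_re hFG
  rw [h4]

/-- **The square inequality** `0 ≤ a²‖F‖² + b²‖G‖² + 2ab Re⟨F, G⟩` for `F, G ∈ L²`. [folklore] -/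
theorem sq_comb_nonneg {F G : α → ℂ} (hF : MemLp F 2 μ) (hG : MemLp G 2 μ) (a b : ℝ) :
    0 ≤ a ^ 2 * ∫ x, ‖F x‖ ^ 2 ∂μ + b ^ 2 * ∫ x, ‖G x‖ ^ 2 ∂μ + 2 * a * b * (∫ x, conj (F x) * G x ∂μ).re := by
  rw [← integral_norm_sq_real_comb hF hG a b]
  exact integral_nonneg fun x => sq_nonneg _

/-- `Re⟨F, G⟩ = Re⟨G, F⟩`. [folklore] -/
theorem re_integral_conj_mul_comm (F G : α → ℂ) :
    (∫ x, conj (F x) * G x ∂μ).re = (∫ x, conj (G x) * F x ∂μ).re := by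
  have h : (fun x => conj (G x) * F x) = fun x => conj (conj (F x) * G x) := by
    funext x; rw [map_mul, Complex.conj_conj, mul_comm]
  rw [h, integral_conj]
  simp

end L2

/-! ### Finite forms as real numbers; measurability in the momentum -/

section Prep

variable {n : ℕ}

/-- The kinetic form splits in real numbers: `𝒯.toReal + (b/ℓ²)·n₊.toReal ≤ kin.toReal` when `kin < ∞`,
`b ≥ 0`. [cite: Fournais2020, (2.7), (2.30), (2.43)] -/
theorem toReal_kinExcForm_add_le (χ : Space → ℝ) (ℓ s : ℝ) {b : ℝ} (hb : 0 ≤ b / ℓ ^ 2) (u : Space)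
    (Φ : Config n → ℂ) (hkin : kinBoxN χ ℓ s b u Φ ≠ ⊤) (hnp : nPlusBoxN ℓ u Φ ≠ ⊤) :
    kinExcForm χ ℓ s u Φ ≠ ⊤ ∧
      (kinExcForm χ ℓ s u Φ).toReal + b / ℓ ^ 2 * (nPlusBoxN ℓ u Φ).toReal ≤ (kinBoxN χ ℓ s b u Φ).toReal := by
  have h := kinExcForm_add_le_kinBoxN χ ℓ s b u Φ
  have hfin : kinExcForm χ ℓ s u Φ + ENNReal.ofReal (b / ℓ ^ 2) * nPlusBoxN ℓ u Φ ≠ ⊤ := ne_top_of_le_ne_top hkin h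
  have hT : kinExcForm χ ℓ s u Φ ≠ ⊤ := (ENNReal.add_ne_top.1 hfin).1
  refine ⟨hT, ?_⟩
  have := ENNReal.toReal_mono hkin h
  rwa [ENNReal.toReal_add hT (ENNReal.mul_ne_top ENNReal.ofReal_ne_top hnp), ENNReal.toReal_mul,
    ENNReal.toReal_ofReal hb] at this

/-- Measurability of `p ↦ ‖b_pΦ‖²_{L²(Λⁿ)}`. [folklore] -/
theorem measurable_lintegral_normSq_bVec {χ : Space → ℝ} (hχ : Continuous χ) (ℓ : ℝ) (u : Space)
    {Φ : Config n → ℂ} (hΦ : Measurable Φ) :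
    Measurable fun p : Space => ∫⁻ X in boxConfig n ℓ u, ((‖bVec χ ℓ u p Φ X‖₊ : ℝ≥0∞)) ^ 2 :=
  ((((measurable_bVec hχ ℓ u hΦ).comp measurable_swap).nnnorm.coe_nnreal_ennreal).pow_const 2).lintegral_prod_right'

/-- `b_{-p}` of `Φ` is `b_p` composed with `p ↦ -p`: measurability of `p ↦ ‖b_{-p}Φ‖²`. [folklore] -/
theorem measurable_lintegral_normSq_bVec_neg {χ : Space → ℝ} (hχ : Continuous χ) (ℓ : ℝ) (u : Space)
    {Φ : Config n → ℂ} (hΦ : Measurable Φ) :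
    Measurable fun p : Space => ∫⁻ X in boxConfig n ℓ u, ((‖bVec χ ℓ u (-p) Φ X‖₊ : ℝ≥0∞)) ^ 2 :=
  (measurable_lintegral_normSq_bVec hχ ℓ u hΦ).comp measurable_neg

end Prep


/-! ### Real bookkeeping lemmas -/

/-- AM–GM for the middle error term: `a²n/ℓ⁴ ≤ ½(a/ℓ³ + a³n²/ℓ⁵)`. [folklore] -/
theorem amgm_middle {a ℓ n : ℝ} (ha : 0 ≤ a) (hℓ : 0 < ℓ) :
    a ^ 2 * n / ℓ ^ 4 ≤ (a / ℓ ^ 3 + a ^ 3 * n ^ 2 / ℓ ^ 5) / 2 := by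
  rw [div_add_div _ _ (by positivity) (by positivity), div_div, le_div_iff₀ (by positivity),
    div_mul_eq_mul_div, div_le_iff₀ (by positivity)]
  nlinarith [sq_nonneg (a * n * ℓ ^ 3 - ℓ ^ 4), sq_nonneg (a * ℓ ^ 5 * n - ℓ ^ 6), mul_pos hℓ hℓ,
    sq_nonneg (a * n * ℓ ^ 4 - ℓ ^ 5), pow_pos hℓ 9, pow_pos hℓ 4,
    sq_nonneg (a * n * ℓ - ℓ ^ 2), mul_nonneg (sq_nonneg (a * n * ℓ ^ 2 - ℓ ^ 3)) (mul_nonneg ha (pow_pos hℓ 3).le)]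

/-- (A) The main term: `(n/2)N₂·(n/ℓ³)(1+ε)²G ≤ (n(n+1)/(2ℓ³))G N₂ + 12 n² ε a/ℓ³ · N₂` for `0 ≤ ε ≤ 1`,
`0 ≤ G ≤ 8πa` (so that `(1+ε)² ≤ 1 + 3ε`). [cite: Fournais2020, (2.36), (2.42)] -/
theorem lemma24_main_term {n ℓ a ε G N2 : ℝ} (hn : 0 ≤ n) (hℓ : 0 < ℓ) (hε0 : 0 ≤ ε) (hε : ε ≤ 1)
    (hG0 : 0 ≤ G) (hG : G ≤ 8 * Real.pi * a) (hN2 : 0 ≤ N2) :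
    n / 2 * N2 * (n / ℓ ^ 3 * (1 + ε) ^ 2 * G) ≤
      n * (n + 1) / (2 * ℓ ^ 3) * G * N2 + 12 * Real.pi * (n * n / ℓ ^ 3) * ε * a * N2 := by
  have hsq : (1 + ε) ^ 2 ≤ 1 + 3 * ε := by nlinarith
  have hx : 0 ≤ n * n / ℓ ^ 3 * N2 := by positivity
  -- rewrite both sides in terms of `x = n²N₂/ℓ³`
  have hL : n / 2 * N2 * (n / ℓ ^ 3 * (1 + ε) ^ 2 * G) = (n * n / ℓ ^ 3 * N2) * ((1 + ε) ^ 2 * G) / 2 := by ring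
  have hR : n * (n + 1) / (2 * ℓ ^ 3) * G * N2 + 12 * Real.pi * (n * n / ℓ ^ 3) * ε * a * N2 =
      (n * n / ℓ ^ 3 * N2) * (G + 24 * Real.pi * ε * a) / 2 + n / (2 * ℓ ^ 3) * G * N2 := by ring
  rw [hL, hR]
  have h1 : (1 + ε) ^ 2 * G ≤ (1 + 3 * ε) * G := mul_le_mul_of_nonneg_right hsq hG0
  have h2 : (1 + 3 * ε) * G ≤ G + 24 * Real.pi * ε * a := by nlinarith [mul_le_mul_of_nonneg_left hG hε0]
  have h3 : 0 ≤ n / (2 * ℓ ^ 3) * G * N2 := by positivity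
  have h4 := mul_le_mul_of_nonneg_left (h1.trans h2) hx
  linarith

/-- (B) The error integral: with `E ≤ c₁ a/ℓ³ + 64 a²n/(sℓ⁴) + c₃ a³n²/ℓ⁵`,
`(n/2)N₂E ≤ nN₂((c₁/2 + 16/s) a/ℓ³ + (16/s + c₃/2) a³n²/ℓ⁵)` (AM–GM on the middle term).
[cite: Fournais2020, (2.37)–(2.41)] -/
theorem lemma24_E_term {n ℓ a s c₁ c₃ E N2 : ℝ} (hn : 0 ≤ n) (hℓ : 0 < ℓ) (ha : 0 ≤ a) (hs : 0 < s) (hN2 : 0 ≤ N2)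
    (hE : E ≤ c₁ * (a / ℓ ^ 3) + 64 * (a ^ 2 * n / (s * ℓ ^ 4)) + c₃ * (a ^ 3 * n ^ 2 / ℓ ^ 5)) :
    n / 2 * N2 * E ≤ n * N2 * ((c₁ / 2 + 16 / s) * (a / ℓ ^ 3) + (16 / s + c₃ / 2) * (a ^ 3 * n ^ 2 / ℓ ^ 5)) := by
  have hmid := amgm_middle ha hℓ (n := n)
  have hm := mul_le_mul_of_nonneg_left hmid (show (0 : ℝ) ≤ 64 / s by positivity)
  have e1 : 64 * (a ^ 2 * n / (s * ℓ ^ 4)) = 64 / s * (a ^ 2 * n / ℓ ^ 4) := by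
    field_simp
  have hE2 : E ≤ (c₁ + 32 / s) * (a / ℓ ^ 3) + (32 / s + c₃) * (a ^ 3 * n ^ 2 / ℓ ^ 5) := by
    have e2 : 64 / s * ((a / ℓ ^ 3 + a ^ 3 * n ^ 2 / ℓ ^ 5) / 2) =
        32 / s * (a / ℓ ^ 3) + 32 / s * (a ^ 3 * n ^ 2 / ℓ ^ 5) := by ring
    linarith
  have hn2 : 0 ≤ n / 2 * N2 := by positivity
  calc n / 2 * N2 * E ≤ n / 2 * N2 * ((c₁ + 32 / s) * (a / ℓ ^ 3) + (32 / s + c₃) * (a ^ 3 * n ^ 2 / ℓ ^ 5)) :=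
        mul_le_mul_of_nonneg_left hE2 hn2
    _ = _ := by ring


/-- (a) The error `E` of `lintegral_bogoliubov_integrand_le` at `κ = ℓ³/n`, `σ = (sℓ)⁻¹`, `r₀ = σ/π`,
`W₀ ≤ 16πa`: `E ≤ 32/(3πs³)·a/ℓ³ + 64 a²n/(sℓ⁴) + 3072πs·a³n²/ℓ⁵`. [cite: Fournais2020, (2.37)–(2.41)] -/
theorem lemma24_E_bound {n ℓ a s W0 : ℝ} (hn : 0 < n) (hℓ : 0 < ℓ) (hs : 0 < s) (hW0 : 0 ≤ W0)
    (hW : W0 ≤ 16 * Real.pi * a) :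
    W0 / 2 * (4 / 3 * Real.pi * ((s * ℓ)⁻¹ / Real.pi) ^ 3) +
        (W0 ^ 2 * (ℓ ^ 3 / n * (s * ℓ)⁻¹ ^ 2 + 2 * W0) + W0 ^ 3) / (16 * Real.pi ^ 4 * (ℓ ^ 3 / n) ^ 2) *
          (4 * Real.pi / ((s * ℓ)⁻¹ / Real.pi)) ≤
      32 / (3 * Real.pi * s ^ 3) * (a / ℓ ^ 3) + 64 * (a ^ 2 * n / (s * ℓ ^ 4)) +
        3072 * Real.pi * s * (a ^ 3 * n ^ 2 / ℓ ^ 5) := by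
  have hπ := Real.pi_pos
  -- the three pieces, written as monomials
  have e1 : W0 / 2 * (4 / 3 * Real.pi * ((s * ℓ)⁻¹ / Real.pi) ^ 3) = W0 * (2 / (3 * Real.pi ^ 2 * s ^ 3 * ℓ ^ 3)) := by
    field_simp
    ring
  have e2 : (W0 ^ 2 * (ℓ ^ 3 / n * (s * ℓ)⁻¹ ^ 2 + 2 * W0) + W0 ^ 3) / (16 * Real.pi ^ 4 * (ℓ ^ 3 / n) ^ 2) *
      (4 * Real.pi / ((s * ℓ)⁻¹ / Real.pi)) =
      W0 ^ 2 * (n / (4 * Real.pi ^ 2 * s * ℓ ^ 4)) + W0 ^ 3 * (3 * s * n ^ 2 / (4 * Real.pi ^ 2 * ℓ ^ 5)) := by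
    field_simp
    ring
  rw [e1, e2]
  have hW2 : W0 ^ 2 ≤ (16 * Real.pi * a) ^ 2 := pow_le_pow_left₀ hW0 hW 2
  have hW3 : W0 ^ 3 ≤ (16 * Real.pi * a) ^ 3 := pow_le_pow_left₀ hW0 hW 3
  have t1 : W0 * (2 / (3 * Real.pi ^ 2 * s ^ 3 * ℓ ^ 3)) ≤ 16 * Real.pi * a * (2 / (3 * Real.pi ^ 2 * s ^ 3 * ℓ ^ 3)) :=
    mul_le_mul_of_nonneg_right hW (by positivity)
  have t2 : W0 ^ 2 * (n / (4 * Real.pi ^ 2 * s * ℓ ^ 4)) ≤ (16 * Real.pi * a) ^ 2 * (n / (4 * Real.pi ^ 2 * s * ℓ ^ 4)) :=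
    mul_le_mul_of_nonneg_right hW2 (by positivity)
  have t3 : W0 ^ 3 * (3 * s * n ^ 2 / (4 * Real.pi ^ 2 * ℓ ^ 5)) ≤ (16 * Real.pi * a) ^ 3 * (3 * s * n ^ 2 / (4 * Real.pi ^ 2 * ℓ ^ 5)) :=
    mul_le_mul_of_nonneg_right hW3 (by positivity)
  have f1 : 16 * Real.pi * a * (2 / (3 * Real.pi ^ 2 * s ^ 3 * ℓ ^ 3)) = 32 / (3 * Real.pi * s ^ 3) * (a / ℓ ^ 3) := by
    field_simp
    ring
  have f2 : (16 * Real.pi * a) ^ 2 * (n / (4 * Real.pi ^ 2 * s * ℓ ^ 4)) = 64 * (a ^ 2 * n / (s * ℓ ^ 4)) := by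
    field_simp; ring
  have f3 : (16 * Real.pi * a) ^ 3 * (3 * s * n ^ 2 / (4 * Real.pi ^ 2 * ℓ ^ 5)) = 3072 * Real.pi * s * (a ^ 3 * n ^ 2 / ℓ ^ 5) := by
    field_simp; ring
  linarith


/-! ### The integrated completion of the square -/

section Core

variable {n : ℕ}

/-- **Fournais 2020, (2.33)–(2.34) integrated over the momentum.** For a measurable `Φ` with finite norm,
weights `𝒜 ≥ |Wh|`, `𝒜 > 0`, both even, and integrable `𝒜‖b_pΦ‖²`, `Wh·Re⟨b_p†Φ,b_{-p}Φ⟩`, `𝒜 - √(𝒜²-Wh²)`: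
`∫𝒜‖b_pΦ‖² + ∫Wh Re⟨b_p†Φ, b_{-p}Φ⟩ ≥ -(n/2)‖Φ‖² ∫(𝒜 - √(𝒜² - Wh²))` (the square per `±p` pair,
the commutator bound (2.28), and `p ↦ -p`). [cite: Fournais2020, (2.28), (2.33)–(2.34)] -/
theorem integral_pairing_lower_bound (h228 : Fournais2020_eq228) {χ : Space → ℝ} (hχ : IsLocalizationFunction χ)
    {ℓ : ℝ} (hℓ : 0 < ℓ) (u : Space) {Φ : Config n → ℂ} (hΦ : Measurable Φ)
    (hN2 : (∫⁻ X in boxConfig n ℓ u, ((‖Φ X‖₊ : ℝ≥0∞)) ^ 2) ≠ ⊤)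
    (hNb : (∫⁻ p : Space, ∫⁻ X in boxConfig n ℓ u, ((‖bVec χ ℓ u p Φ X‖₊ : ℝ≥0∞)) ^ 2) ≠ ⊤)
    (hDm : ∀ p : Space, AEStronglyMeasurable (bDagVec χ ℓ u p Φ) (volume.restrict (boxConfig n ℓ u)))
    {A Wh : Space → ℝ} (hAW : ∀ p, |Wh p| ≤ A p) (hA0 : ∀ p, 0 < A p) (hAe : ∀ p, A (-p) = A p)
    (hWe : ∀ p, Wh (-p) = Wh p)
    (hIN : Integrable fun p : Space => A p * (∫⁻ X in boxConfig n ℓ u, ((‖bVec χ ℓ u p Φ X‖₊ : ℝ≥0∞)) ^ 2).toReal)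
    (hIP : Integrable fun p : Space => Wh p * pairingRe χ ℓ u p Φ)
    {D : Space → ℝ} (hDA : ∀ p, D p = A p - Real.sqrt (A p ^ 2 - Wh p ^ 2)) (hID : Integrable D) :
    -((n : ℝ) / 2 * (∫⁻ X in boxConfig n ℓ u, ((‖Φ X‖₊ : ℝ≥0∞)) ^ 2).toReal * ∫ p : Space, D p) ≤
      (∫ p : Space, A p * (∫⁻ X in boxConfig n ℓ u, ((‖bVec χ ℓ u p Φ X‖₊ : ℝ≥0∞)) ^ 2).toReal) +
        ∫ p : Space, Wh p * pairingRe χ ℓ u p Φ := by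
  set μ : Measure (Config n) := volume.restrict (boxConfig n ℓ u) with hμ
  set Nb : Space → ℝ≥0∞ := fun p => ∫⁻ X in boxConfig n ℓ u, ((‖bVec χ ℓ u p Φ X‖₊ : ℝ≥0∞)) ^ 2 with hNb_def
  set N2 : ℝ := (∫⁻ X in boxConfig n ℓ u, ((‖Φ X‖₊ : ℝ≥0∞)) ^ 2).toReal with hN2_def
  set f : Space → ℝ := fun p => A p * (Nb p).toReal + Wh p * pairingRe χ ℓ u p Φ with hf
  have hfi : Integrable f := hIN.add hIP
  -- a.e. finiteness of `‖b_{±p}Φ‖²`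
  have hNbm : Measurable Nb := measurable_lintegral_normSq_bVec hχ.contDiff.continuous ℓ u hΦ
  have hae1 : ∀ᵐ p : Space, Nb p < ⊤ := ae_lt_top hNbm hNb
  have hae2 : ∀ᵐ p : Space, Nb (-p) < ⊤ :=
    (Measure.measurePreserving_neg (volume : Measure Space)).quasiMeasurePreserving.ae hae1
  -- the pointwise inequality for a.e. `p`
  have hpt : ∀ᵐ p : Space, -((n : ℝ) * D p * N2) ≤ f p + f (-p) := by
    filter_upwards [hae1, hae2] with p hp1 hp2
    -- the four vectors in `L²(Λⁿ)`
    have hbm : ∀ q : Space, AEStronglyMeasurable (bVec χ ℓ u q Φ) μ := fun q =>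
      ((measurable_bVec hχ.contDiff.continuous ℓ u hΦ).comp (measurable_prodMk_right (y := q))).aestronglyMeasurable
    have hF : MemLp (bVec χ ℓ u p Φ) 2 μ := memLp_two_of_lintegral_ne_top (hbm p) hp1.ne
    have hF' : MemLp (bVec χ ℓ u (-p) Φ) 2 μ := memLp_two_of_lintegral_ne_top (hbm (-p)) hp2.ne
    have hD : ∀ q : Space, (∫⁻ X, ((‖bDagVec χ ℓ u q Φ X‖₊ : ℝ≥0∞)) ^ 2 ∂μ) ≤ Nb q + n * ENNReal.ofReal N2 := by
      intro q
      have h := h228 χ hχ ℓ hℓ u n Φ hΦ q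
      rwa [hN2_def, ENNReal.ofReal_toReal hN2]
    have hDfin : ∀ q : Space, Nb q < ⊤ → (∫⁻ X, ((‖bDagVec χ ℓ u q Φ X‖₊ : ℝ≥0∞)) ^ 2 ∂μ) ≠ ⊤ := fun q hq =>
      ne_top_of_le_ne_top (ENNReal.add_ne_top.2 ⟨hq.ne, ENNReal.mul_ne_top (ENNReal.natCast_ne_top n) ENNReal.ofReal_ne_top⟩) (hD q)
    have hG : MemLp (bDagVec χ ℓ u (-p) Φ) 2 μ := memLp_two_of_lintegral_ne_top (hDm (-p)) (hDfin (-p) hp2)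
    have hG' : MemLp (bDagVec χ ℓ u p Φ) 2 μ := memLp_two_of_lintegral_ne_top (hDm p) (hDfin p hp1)
    -- the scalars
    set Nr : ℝ := (Nb p).toReal + (Nb (-p)).toReal with hNr
    set Mr : ℝ := (∫⁻ X, ((‖bDagVec χ ℓ u (-p) Φ X‖₊ : ℝ≥0∞)) ^ 2 ∂μ).toReal +
      (∫⁻ X, ((‖bDagVec χ ℓ u p Φ X‖₊ : ℝ≥0∞)) ^ 2 ∂μ).toReal with hMr
    set Pr : ℝ := pairingRe χ ℓ u p Φ + pairingRe χ ℓ u (-p) Φ with hPr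
    have hsq : ∀ α β : ℝ, 0 ≤ α ^ 2 * Nr + β ^ 2 * Mr + 2 * α * β * Pr := by
      intro α β
      have h1 := sq_comb_nonneg hF hG α β
      have h2 := sq_comb_nonneg hF' hG' α β
      rw [integral_norm_sq_eq_toReal (hbm p), integral_norm_sq_eq_toReal (hDm (-p)),
        re_integral_conj_mul_comm] at h1
      rw [integral_norm_sq_eq_toReal (hbm (-p)), integral_norm_sq_eq_toReal (hDm p),
        re_integral_conj_mul_comm] at h2
      have e1 : (∫ X, conj (bDagVec χ ℓ u (-p) Φ X) * bVec χ ℓ u p Φ X ∂μ).re = pairingRe χ ℓ u (-p) Φ := by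
        rw [pairingRe, neg_neg]
      have e2 : (∫ X, conj (bDagVec χ ℓ u p Φ X) * bVec χ ℓ u (-p) Φ X ∂μ).re = pairingRe χ ℓ u p Φ := rfl
      rw [e1] at h1
      rw [e2] at h2
      rw [hNr, hMr, hPr]
      nlinarith [h1, h2]
    have hcomm : Mr ≤ Nr + 2 * n * N2 := by
      have hq1 := ENNReal.toReal_mono (ENNReal.add_ne_top.2 ⟨hp2.ne, ENNReal.mul_ne_top (ENNReal.natCast_ne_top n)
        ENNReal.ofReal_ne_top⟩) (hD (-p))
      have hq2 := ENNReal.toReal_mono (ENNReal.add_ne_top.2 ⟨hp1.ne, ENNReal.mul_ne_top (ENNReal.natCast_ne_top n)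
        ENNReal.ofReal_ne_top⟩) (hD p)
      have hN20 : 0 ≤ N2 := ENNReal.toReal_nonneg
      rw [ENNReal.toReal_add hp2.ne (ENNReal.mul_ne_top (ENNReal.natCast_ne_top n) ENNReal.ofReal_ne_top),
        ENNReal.toReal_mul, ENNReal.toReal_natCast, ENNReal.toReal_ofReal hN20] at hq1
      rw [ENNReal.toReal_add hp1.ne (ENNReal.mul_ne_top (ENNReal.natCast_ne_top n) ENNReal.ofReal_ne_top),
        ENNReal.toReal_mul, ENNReal.toReal_natCast, ENNReal.toReal_ofReal hN20] at hq2
      rw [hMr, hNr]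
      linarith
    have hb := bogoliubov_completion hsq hcomm (hA0 p) (hAW p)
    -- `f p + f (-p) = 𝒜N + WhP` by evenness
    have hff : f p + f (-p) = A p * Nr + Wh p * Pr := by
      rw [hf]; simp only [hAe, hWe]; rw [hNr, hPr]; ring
    rw [hff, hDA p]
    linarith
  -- integrate
  have hint : ∫ p, (f p + f (-p)) = 2 * ((∫ p : Space, A p * (Nb p).toReal) + ∫ p : Space, Wh p * pairingRe χ ℓ u p Φ) := by
    rw [integral_add hfi hfi.comp_neg, integral_neg_eq_self f, hf, integral_add hIN hIP]
    ring
  have hi1 : Integrable (fun p : Space => -((n : ℝ) * D p * N2)) := ((hID.const_mul _).mul_const _).neg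
  have hi2 : Integrable (fun p : Space => f p + f (-p)) := hfi.add hfi.comp_neg
  have hmono := integral_mono_ae hi1 hi2 hpt
  rw [hint, integral_neg, integral_mul_const, integral_const_mul] at hmono
  linarith

end Core

/-! ### Evenness, measurability and integrability inputs -/

section Inputs

variable {n : ℕ}

/-- `W₁` is even. [cite: Fournais2020, (2.8)] -/
theorem bigW₁_neg (v : ℝ → ℝ≥0∞) {ω : Space → ℝ} (hω : IsScatteringSolution v ω) {χ : Space → ℝ}
    (hχ : IsLocalizationFunction χ) (ℓ : ℝ) (x : Space) : bigW₁ v ω χ ℓ (-x) = bigW₁ v ω χ ℓ x := by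
  unfold bigW₁
  rw [norm_neg, hω.radial (-x) x (norm_neg x), smul_neg, hχ.selfConv_neg]

/-- `Ŵ₁` is even. [cite: Fournais2020, (2.29)] -/
theorem fourier_bigW₁_neg (v : ℝ → ℝ≥0∞) {ω : Space → ℝ} (hω : IsScatteringSolution v ω) {χ : Space → ℝ}
    (hχ : IsLocalizationFunction χ) (ℓ : ℝ) (p : Space) :
    𝓕 (fun x : Space => ((bigW₁ v ω χ ℓ x).toReal : ℂ)) (-p) = 𝓕 (fun x : Space => ((bigW₁ v ω χ ℓ x).toReal : ℂ)) p := by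
  rw [← Real.fourierInv_eq_fourier_neg, Real.fourierInv_eq_fourier_comp_neg]
  simp_rw [bigW₁_neg v hω hχ ℓ]

/-- `b_p†Φ` is measurable in `X`. [cite: Fournais2020, (2.27)] -/
theorem measurable_bDagVec {χ : Space → ℝ} (hχ : Continuous χ) (ℓ : ℝ) (u p : Space) {Φ : Config n → ℂ}
    (hΦ : Measurable Φ) : Measurable (bDagVec χ ℓ u p Φ) := by
  unfold bDagVec
  refine Finset.measurable_sum _ fun i _ => ?_
  have hw : Measurable (locWave χ ℓ u p) := by
    unfold locWave locFun
    refine (Complex.measurable_ofReal.comp (hχ.measurable.comp (measurable_const_smul _ |>.comp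
      (measurable_id.sub measurable_const)))).mul ?_
    exact (continuous_subtype_val.comp (Real.continuous_fourierChar.comp (continuous_id.inner continuous_const))).measurable
  have hq : Measurable (projQ ℓ u (locWave χ ℓ u p)) :=
    (hw.sub measurable_const).indicator (measurableSet_slidingBox ℓ u)
  exact (hq.comp (measurable_pi_apply i)).mul (measurable_nbodyP ℓ u i hΦ)

/-- From `∫⁻ g·N ≤ B < ∞` to the real integral: `g·N.toReal` is integrable with `∫ g N.toReal ≤ B.toReal`.
[folklore] -/
theorem integrable_and_integral_le {g : Space → ℝ} (hg : Measurable g) (hg0 : ∀ p, 0 ≤ g p) {N : Space → ℝ≥0∞}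
    (hN : Measurable N) {B : ℝ≥0∞} (hB : ∫⁻ p, ENNReal.ofReal (g p) * N p ≤ B) (hBt : B ≠ ⊤) :
    Integrable (fun p => g p * (N p).toReal) ∧ ∫ p, g p * (N p).toReal ≤ B.toReal := by
  have hFm : Measurable fun p => ENNReal.ofReal (g p) * N p := hg.ennreal_ofReal.mul hN
  have hFt : (∫⁻ p, ENNReal.ofReal (g p) * N p) ≠ ⊤ := ne_top_of_le_ne_top hBt hB
  have heq : (fun p => g p * (N p).toReal) = fun p => (ENNReal.ofReal (g p) * N p).toReal := by
    funext p; rw [ENNReal.toReal_mul, ENNReal.toReal_ofReal (hg0 p)]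
  rw [heq]
  refine ⟨integrable_toReal_of_lintegral_ne_top hFm.aemeasurable hFt, ?_⟩
  rw [integral_toReal hFm.aemeasurable (ae_lt_top hFm hFt)]
  exact ENNReal.toReal_mono hBt hB

/-- A nonnegative measurable real function with `∫⁻ ofReal f ≤ B < ∞` is integrable with `∫f ≤ B.toReal`.
[folklore] -/
theorem integrable_and_integral_le' {f : Space → ℝ} (hf : Measurable f) (hf0 : ∀ p, 0 ≤ f p) {B : ℝ≥0∞}
    (hB : ∫⁻ p, ENNReal.ofReal (f p) ≤ B) (hBt : B ≠ ⊤) : Integrable f ∧ ∫ p, f p ≤ B.toReal := by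
  have h := integrable_and_integral_le hf hf0 (N := fun _ => 1) measurable_const (B := B) (by simpa using hB) hBt
  simpa using h

end Inputs

end Literature.MathematicalPhysics.QuantumManyBody.BoseGas

end
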